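import Literature.NumberTheory.Automorphic.ResiduallyRegularOrbitalIntegralClosed
import Mathlib.RingTheory.Polynomial.Resultant.Basic
import HarnessLib

/-!
# Residually separable ⇒ separable: `hγs ⟸ hsep` for `γ ∈ GL_n(𝒪_E)`
(Kottwitz, *Base change for unit elements of Hecke algebras* (1986), Prop. 7.1: «if the reduction of
the characteristic polynomial of `γ` is separable then `γ` is regular semisimple»)

Topic `NumberTheory/Automorphic`; namespace `Literature.NumberTheory.Automorphic`. THEOREMS ONLY (no
definition, no instance, no named fact, no `sorry`). Road letter «D-S3u» residue (r2) of the cell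
`hodgecm-mathlib` (A-p01 (g20) census 3520b882; LEAD F0P3a-plan (g8) T7-83): the two dischargers
★ `GLn.setOf_mem_glInt_eq_compactCore_centralizer` (B-p14, (c4)) and the closed unit-element heads of
★ `ResiduallyRegularOrbitalIntegralClosed` carry, besides Kottwitz's hypothesis
`hsep : (redMat γ).charpoly.Separable` (separable REDUCTION), the binder
`hγs : (charpoly γ).Separable` (separable over `E`). The second follows from the first:

* §1 (pure algebra) `Monic.separable_of_separable_map_residue` — over a local ring `R`, a MONIC
  `f ∈ R[X]` whose reduction `f̄ ∈ κ[X]` is separable is separable: `Res(f̄, f̄′)` is a unit of `κ`,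
  it is the residue of `Res(f, f′)` (Sylvester determinant, `resultant_map_map`; the degree drop of
  `f′` modulo `𝔪` is absorbed by `resultant_add_right_deg` since `f̄` is monic), so `Res(f, f′)` is
  a unit of `R` and `f, f′` are coprime (`isUnit_resultant_iff_isCoprime`).
* §2 `GLn.charpoly_separable_of_separable_redMat` — for `γ ∈ glInt n E = GL_n(𝒪_E)` with
  `(redMat γ).charpoly` separable, `charpoly γ` is separable over `E`.
* §3 riders, BY NAME over ★ (c4) and ★ `ResiduallyRegularOrbitalIntegralClosed`: the same heads with
  the `hγs` binder dropped — `GLn.setOf_mem_glInt_eq_compactCore_centralizer_of_separable_redMat`,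
  `GLn.orbitalIntegral_indicator_glInt_eq_of_separable_redMat_of_compactCore'`,
  `GLn.classOrbitalIntegral_indicator_glInt_eq_of_isCanonical_of_separable_redMat'` (`_eq_one_…'`,
  `_complex_…_eq_one_…'`).

## References

* R. E. Kottwitz, *Base change for unit elements of Hecke algebras*, Compositio Math. 60 (1986),
  Prop. 7.1 [Kottwitz1986].
* J. D. Rogawski, *Automorphic Representations of Unitary Groups in Three Variables* (1990), §4.9
  p. 54 [Rogawski1990].
-/

noncomputable section

open MeasureTheory Measure Topology Set Filter Function Polynomial
open Literature.MeasureTheory.Group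
open Literature.NumberTheory.Automorphic.IntegralReduction
open scoped ENNReal NNReal MatrixGroups Polynomial ValuativeRel

namespace Literature.NumberTheory.Automorphic

/-! ## §1 Separability lifts from the residue field for monic polynomials -/

section Algebra

variable {R : Type*} [CommRing R] [IsLocalRing R]

/-- **A monic polynomial over a local ring whose reduction is separable is separable.** For `R` local
with residue map `R → κ` and `f ∈ R[X]` monic: `(f̄).Separable → f.Separable`. (The resultant
`Res(f, f′)` reduces to `Res(f̄, f̄′)`, a unit; units lift along the local map `R → κ`; a monic `f` is
coprime to `g` iff `Res(f, g)` is a unit.) This is the algebra behind Kottwitz's «`γ̄` has separable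
characteristic polynomial ⇒ `γ` is regular semisimple». [cite: Kottwitz1986, Prop. 7.1] -/
theorem Monic.separable_of_separable_map_residue {f : R[X]} (hf : f.Monic)
    (h : (f.map (IsLocalRing.residue R)).Separable) : f.Separable := by
  nontriviality R
  set φ := IsLocalRing.residue R with hφ
  have hfm : (f.map φ).Monic := hf.map φ
  -- `Res(f̄, f̄′)` (at the degrees of `f̄`, `f̄′`) is a unit of the residue field
  have h1 : IsUnit (resultant (f.map φ) (derivative (f.map φ))) :=
    (isUnit_resultant_iff_isCoprime hfm).2 h
  rw [derivative_map] at h1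
  -- absorb the degree drop of `f′` modulo `𝔪`: pad the second degree up to `natDegree f′`
  obtain ⟨k, hk⟩ : ∃ k, (derivative f).natDegree = ((derivative f).map φ).natDegree + k :=
    ⟨_, (Nat.add_sub_cancel' natDegree_map_le).symm⟩
  have h2 : IsUnit (resultant (f.map φ) ((derivative f).map φ) f.natDegree (derivative f).natDegree) := by
    rw [hk, resultant_add_right_deg _ _ _ _ k le_rfl, ← hf.natDegree_map φ, hfm.coeff_natDegree, one_pow,
      one_mul, hf.natDegree_map φ]
    convert h1 using 2
    exact (hf.natDegree_map φ).symm
  -- it is the residue of `Res(f, f′)`, hence `Res(f, f′)` is a unit of `R`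
  rw [resultant_map_map, isUnit_map_iff] at h2
  exact (isUnit_resultant_iff_isCoprime hf).1 h2

end Algebra

/-! ## §2 `γ ∈ GL_n(𝒪_E)` residually separable ⇒ `charpoly γ` separable -/

section GLn

universe u

variable {E : Type u} [Field E] [ValuativeRel E] {n : ℕ}

/-- **`hγs ⟸ hsep`**: for `γ ∈ GL_n(𝒪_E) ≤ GL_n(E)` (★ `glInt`) whose reduced matrix `redMat γ` has
separable characteristic polynomial, the characteristic polynomial of `γ` over `E` is separable
(§1 applied to `charpoly γ_𝒪 ∈ 𝒪_E[X]`, monic, via ★ `GLn.charpoly_redMat_map_eq` and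
`Matrix.charpoly_map`). [cite: Kottwitz1986, Prop. 7.1] [cite: Rogawski1990, §4.9 p. 54] -/
theorem GLn.charpoly_separable_of_separable_redMat {γ : GL (Fin n) E} (hγ : γ ∈ glInt n E)
    (hsep : (redMat ((γ : GL (Fin n) E) : Matrix (Fin n) (Fin n) E)).charpoly.Separable) :
    ((γ : GL (Fin n) E) : Matrix (Fin n) (Fin n) E).charpoly.Separable := by
  obtain ⟨γO, rfl⟩ := hγ
  rw [GLn.charpoly_redMat_map_eq] at hsep
  have hO : (γO : Matrix (Fin n) (Fin n) 𝒪[E]).charpoly.Separable :=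
    Monic.separable_of_separable_map_residue (Matrix.charpoly_monic _) hsep
  have e : ((Matrix.GeneralLinearGroup.map (𝒪[E]).subtype γO : GL (Fin n) E) : Matrix (Fin n) (Fin n) E) =
      (𝒪[E]).subtype.mapMatrix (γO : Matrix (Fin n) (Fin n) 𝒪[E]) := rfl
  rw [e, RingHom.mapMatrix_apply, Matrix.charpoly_map]
  exact hO.map

end GLn

/-! ## §3 Riders: the `hγs` binder dropped, by name -/

section CompactCore

universe u

variable {E : Type u} [Field E] [ValuativeRel E] [TopologicalSpace E] [IsNonarchimedeanLocalField E]
  {n : ℕ}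

/-- **★ (c4) without `hγs`**: `G_γ ∩ GL_n(𝒪) = compactCore G_γ` for `γ ∈ GL_n(𝒪_E)` residually
separable (★ `GLn.setOf_mem_glInt_eq_compactCore_centralizer` ∘ §2). [cite: Kottwitz1986, Prop. 7.1] -/
theorem GLn.setOf_mem_glInt_eq_compactCore_centralizer_of_separable_redMat [T2Space (GL (Fin n) E)]
    {γ : GL (Fin n) E} (hγ : γ ∈ glInt n E)
    (hsep : (redMat ((γ : GL (Fin n) E) : Matrix (Fin n) (Fin n) E)).charpoly.Separable) :
    {z : ↥(Subgroup.centralizer ({γ} : Set (GL (Fin n) E))) | (z : GL (Fin n) E) ∈ glInt n E} =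
      compactCore ↥(Subgroup.centralizer ({γ} : Set (GL (Fin n) E))) :=
  GLn.setOf_mem_glInt_eq_compactCore_centralizer hγ (GLn.charpoly_separable_of_separable_redMat hγ hsep) hsep

end CompactCore

section Orbital

variable {E : Type*} [Field E] [ValuativeRel E] [TopologicalSpace E] [IsNonarchimedeanLocalField E]
  {n : ℕ} [MeasurableSpace (GL (Fin n) E)] [BorelSpace (GL (Fin n) E)]
  [SecondCountableTopology (GL (Fin n) E)] [T2Space (GL (Fin n) E)] [LocallyCompactSpace (GL (Fin n) E)]
  (γ : GL (Fin n) E)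
  [MeasurableSpace (GL (Fin n) E ⧸ Subgroup.centralizer ({γ} : Set (GL (Fin n) E)))]
  [BorelSpace (GL (Fin n) E ⧸ Subgroup.centralizer ({γ} : Set (GL (Fin n) E)))]
  [hC : IsClosed ((Subgroup.centralizer ({γ} : Set (GL (Fin n) E)) : Subgroup (GL (Fin n) E)) :
    Set (GL (Fin n) E))]
  (t : Measure ↥(Subgroup.centralizer ({γ} : Set (GL (Fin n) E)))) [t.IsMulLeftInvariant]
  [IsFiniteMeasureOnCompacts t] [t.IsOpenPosMeasure] [t.IsInvInvariant] [SFinite t]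
  (ν : Measure (GL (Fin n) E)) [IsHaarMeasure ν] [ν.IsMulRightInvariant]

/-- **`O_γ^{ν/t}(1_K) = ν(K).toReal`** for the canonically normalised `t` (`t(compactCore G_γ) = 1`) at
`γ ∈ K = GL_n(𝒪_E)` residually separable — ★
`GLn.orbitalIntegral_indicator_glInt_eq_of_separable_redMat_of_compactCore` with `hγs` dropped (§2).
[cite: Kottwitz1986, Prop. 7.1, Cor. 7.3] [cite: Rogawski1990, §4.3 p. 43] -/
theorem GLn.orbitalIntegral_indicator_glInt_eq_of_separable_redMat_of_compactCore' (hγ : γ ∈ glInt n E)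
    (hsep : (redMat ((γ : GL (Fin n) E) : Matrix (Fin n) (Fin n) E)).charpoly.Separable)
    (ht : t (compactCore ↥(Subgroup.centralizer ({γ} : Set (GL (Fin n) E)))) = 1) :
    orbitalIntegral γ (((glInt n E : Subgroup (GL (Fin n) E)) : Set (GL (Fin n) E)).indicator
        (1 : GL (Fin n) E → ℝ)) (quotientMeasure (Subgroup.centralizer ({γ} : Set (GL (Fin n) E))) t hC ν) =
      (ν (glInt n E : Set (GL (Fin n) E))).toReal :=
  GLn.orbitalIntegral_indicator_glInt_eq_of_separable_redMat_of_compactCore γ t ν hγ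
    (GLn.charpoly_separable_of_separable_redMat hγ hsep) hsep ht

end Orbital

section Canonical

variable {E : Type*} [Field E] [ValuativeRel E] [TopologicalSpace E] [IsNonarchimedeanLocalField E]
  {n : ℕ} [MeasurableSpace (GL (Fin n) E)] [BorelSpace (GL (Fin n) E)]
  [SecondCountableTopology (GL (Fin n) E)] [T2Space (GL (Fin n) E)] [LocallyCompactSpace (GL (Fin n) E)]
  [∀ γ : GL (Fin n) E, MeasurableSpace (GL (Fin n) E ⧸ Subgroup.centralizer ({γ} : Set (GL (Fin n) E)))]
  [∀ γ : GL (Fin n) E, BorelSpace (GL (Fin n) E ⧸ Subgroup.centralizer ({γ} : Set (GL (Fin n) E)))]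
  (ν : Measure (GL (Fin n) E)) [IsHaarMeasure ν] [ν.IsMulRightInvariant]

/-- **Kottwitz's unit-element value, with Kottwitz's hypothesis alone**: for a canonical orbital
measure family `m` for `(P, ν)` and a `P`-class `c` whose representative lies in `K = GL_n(𝒪_E)`
with residually separable characteristic polynomial, `classOrbitalIntegral m 1_K c = ν(K).toReal`
(★ `…_of_isCanonical_of_separable_redMat` with `hγs` dropped). [cite: Kottwitz1986, Prop. 7.1, Cor. 7.3] [cite: Rogawski1990, §4.3 p. 43] -/
theorem GLn.classOrbitalIntegral_indicator_glInt_eq_of_isCanonical_of_separable_redMat'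
    {P : GL (Fin n) E → Prop} {m : OrbitalMeasureFamily (GL (Fin n) E)} (hm : m.IsCanonical P ν)
    (c : ConjClasses (GL (Fin n) E)) (hPc : P (Quotient.out c))
    (hγ : (Quotient.out c : GL (Fin n) E) ∈ glInt n E)
    (hsep : (redMat ((Quotient.out c : GL (Fin n) E) : Matrix (Fin n) (Fin n) E)).charpoly.Separable) :
    classOrbitalIntegral m (((glInt n E : Subgroup (GL (Fin n) E)) : Set (GL (Fin n) E)).indicator
        (1 : GL (Fin n) E → ℝ)) c = (ν (glInt n E : Set (GL (Fin n) E))).toReal :=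
  GLn.classOrbitalIntegral_indicator_glInt_eq_of_isCanonical_of_separable_redMat ν hm c hPc hγ
    (GLn.charpoly_separable_of_separable_redMat hγ hsep) hsep

/-- **`classOrbitalIntegral m 1_K c = 1`** at `ν(K) = 1` for a canonical family, at a residually
separable class (Kottwitz's hypothesis alone). [cite: Kottwitz1986, Cor. 7.3] [cite: Rogawski1990, §4.3 p. 43] -/
theorem GLn.classOrbitalIntegral_indicator_glInt_eq_one_of_isCanonical_of_separable_redMat'
    {P : GL (Fin n) E → Prop} {m : OrbitalMeasureFamily (GL (Fin n) E)} (hm : m.IsCanonical P ν)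
    (c : ConjClasses (GL (Fin n) E)) (hPc : P (Quotient.out c))
    (hγ : (Quotient.out c : GL (Fin n) E) ∈ glInt n E)
    (hsep : (redMat ((Quotient.out c : GL (Fin n) E) : Matrix (Fin n) (Fin n) E)).charpoly.Separable)
    (hν : ν (glInt n E : Set (GL (Fin n) E)) = 1) :
    classOrbitalIntegral m (((glInt n E : Subgroup (GL (Fin n) E)) : Set (GL (Fin n) E)).indicator
        (1 : GL (Fin n) E → ℝ)) c = 1 :=
  GLn.classOrbitalIntegral_indicator_glInt_eq_one_of_isCanonical_of_separable_redMat ν hm c hPc hγ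
    (GLn.charpoly_separable_of_separable_redMat hγ hsep) hsep hν

/-- **`ℂ`-valued: `classOrbitalIntegral m (1_K : G → ℂ) c = 1`** at `ν(K) = 1` for a canonical
family, at a residually separable class (Kottwitz's hypothesis alone) — the transfer letters' test
function. [cite: Kottwitz1986, Cor. 7.3] [cite: Rogawski1990, §4.9 Prop. 4.9.1 (b) p. 55] -/
theorem GLn.classOrbitalIntegral_indicator_complex_glInt_eq_one_of_isCanonical_of_separable_redMat'
    {P : GL (Fin n) E → Prop} {m : OrbitalMeasureFamily (GL (Fin n) E)} (hm : m.IsCanonical P ν)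
    (c : ConjClasses (GL (Fin n) E)) (hPc : P (Quotient.out c))
    (hγ : (Quotient.out c : GL (Fin n) E) ∈ glInt n E)
    (hsep : (redMat ((Quotient.out c : GL (Fin n) E) : Matrix (Fin n) (Fin n) E)).charpoly.Separable)
    (hν : ν (glInt n E : Set (GL (Fin n) E)) = 1) :
    classOrbitalIntegral m (((glInt n E : Subgroup (GL (Fin n) E)) : Set (GL (Fin n) E)).indicator
        fun _ => (1 : ℂ)) c = 1 :=
  GLn.classOrbitalIntegral_indicator_complex_glInt_eq_one_of_isCanonical_of_separable_redMat ν hm c hPc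
    hγ (GLn.charpoly_separable_of_separable_redMat hγ hsep) hsep hν

end Canonical

end Literature.NumberTheory.Automorphic
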